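import Mathlib
import Summits.Ventures.PercRepro2.Defs
import Summits.Ventures.PercRepro2.Independence
import Summits.Ventures.PercRepro2.Harris
import Summits.Ventures.PercRepro2.CoinDefs
import Summits.Ventures.PercRepro2.CoinArcsOff
import Summits.Ventures.PercRepro2.CoinPendantDefs
import Summits.Ventures.PercRepro2.CoinPendant
import Summits.Ventures.PercRepro2.CoinInduced
import Summits.Ventures.PercRepro2.CoinVdBK
import Summits.Ventures.PercRepro2.CoinBHK
import Summits.Ventures.PercRepro2.CoinReverse
import Summits.Ventures.PercRepro2.CoinLemmaA
import Summits.Ventures.PercRepro2.CoinDarcMixed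
import Summits.Ventures.PercRepro2.CoinTwoPendantDefs
import Summits.Ventures.PercRepro2.CoinTwoPendantMass
import Summits.Ventures.PercRepro2.CoinTraceLevels
import Summits.Ventures.PercRepro2.CoinTraceTower
import Summits.Ventures.PercRepro2.CoinTracePin
import Summits.Ventures.PercRepro2.CoinTraceReduce
import Summits.Ventures.PercRepro2.CoinTraceFn
import Summits.Ventures.PercRepro2.CoinTraceBlock
import Summits.Ventures.PercRepro2.CoinTraceShift
import Summits.Ventures.PercRepro2.CoinTwoStarAbstract
import Summits.Ventures.PercRepro2.CoinTwoStar

/-!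
# The ABSTRACT PENDANT LEMMA as a statement, and `APL ⟹ 2′DARC` at every head (blind cell
PercRepro2, night-2 g3; proofs/NIGHT2-DARC.md §21)

`AbstractPendantLemma P w` is NIGHT2-DARC.md (15.3)/(15.6) for the pendant set `P ∋ w`: for every
trace law `μ ≥ 0` on `P.powerset` satisfying (AV-PA) on every avoidance family (`TracePA`), every
decreasing data `x, y ≤ 1` with pivotal data `x̂ ≤ x`, `ŷ ≤ y` (decreasing, equal to `x, y` off
the pivotal family) and every pivotal weight `ρ ∈ [0, 1]`, `= 1` off `{Z ∋ w}`, increasing on it,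
`S′ = Σ_Z μ_Z ρ_Z (x̂_Z Λ − MX)(ŷ_Z Λ − MY) ≥ 0`.  `darc_of_abstractPendantLemma`: for every
closed-out head with pendant set `P`, `AbstractPendantLemma P w ⟹ DARC` — the conjecture of
NIGHT2-DARC.md (15.6) implies row 2′DARC wherever `a, b, u` lie outside `P ∪ {t}`; the exact
certificates of §15.9 are instances of `AbstractPendantLemma` by computation, the sign method
proves it under the good-decomposition condition (§19.5).
-/

namespace Summit.Ventures.PercRepro2.Coin

section APL

open Classical

variable {V : Type*} [DecidableEq V] {R : Type*} [Field R] [LinearOrder R] [IsStrictOrderedRing R]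

/-- **The abstract pendant lemma** for the pendant set `P` and head `w` (NIGHT2-DARC.md (15.3)):
(AV-PA) of the trace law implies `S′ ≥ 0` for all admissible data. -/
def AbstractPendantLemma (P : Finset V) (w : V) : Prop :=
  ∀ μ x y xh yh ρ : Finset V → R,
    (∀ Z ∈ P.powerset, 0 ≤ μ Z) → TracePA P μ →
    (∀ Z : Finset V, Z ⊆ P → x Z ≤ 1) → (∀ Z : Finset V, Z ⊆ P → y Z ≤ 1) →
    (∀ Z : Finset V, Z ⊆ P → xh Z ≤ 1) → (∀ Z : Finset V, Z ⊆ P → yh Z ≤ 1) →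
    (∀ Z Z' : Finset V, Z ⊆ Z' → Z' ⊆ P → x Z' ≤ x Z) →
    (∀ Z Z' : Finset V, Z ⊆ Z' → Z' ⊆ P → y Z' ≤ y Z) →
    (∀ Z Z' : Finset V, Z ⊆ Z' → Z' ⊆ P → xh Z' ≤ xh Z) →
    (∀ Z Z' : Finset V, Z ⊆ Z' → Z' ⊆ P → yh Z' ≤ yh Z) →
    (∀ Z : Finset V, Z ⊆ P → xh Z ≤ x Z) → (∀ Z : Finset V, Z ⊆ P → yh Z ≤ y Z) →
    (∀ Z : Finset V, Z ⊆ P → w ∉ Z → xh Z = x Z) →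
    (∀ Z : Finset V, Z ⊆ P → w ∉ Z → yh Z = y Z) →
    (∀ Z ∈ P.powerset, w ∉ Z → ρ Z = 1) → (∀ Z ∈ P.powerset, 0 ≤ ρ Z) →
    (∀ Z ∈ P.powerset, ρ Z ≤ 1) →
    (∀ Z Z' : Finset V, Z ⊆ Z' → Z' ⊆ P → w ∈ Z → ρ Z ≤ ρ Z') →
    0 ≤ ∑ Z ∈ P.powerset, μ Z * ρ Z *
      (xh Z * (∑ Z' ∈ P.powerset, μ Z') - ∑ Z' ∈ P.powerset, x Z' * μ Z') *
      (yh Z * (∑ Z' ∈ P.powerset, μ Z') - ∑ Z' ∈ P.powerset, y Z' * μ Z')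

end APL

section Reduction

open Classical

variable {V : Type*} {E : Type*} [Fintype V] [DecidableEq V] [Fintype E] [DecidableEq E]
  {R : Type*} [Field R] [LinearOrder R] [IsStrictOrderedRing R]

/-- **`AbstractPendantLemma P w ⟹ DARC` at every closed-out head with pendant set `P`.** -/
theorem darc_of_abstractPendantLemma (p : E → R) (hp : IsProbVec p) {arcs : E → Finset (V × V)}
    (hS : SameEnds arcs) {P : Finset V} {t : V} (hclosed : ClosedOut arcs P {t})
    (hT : TailCoinsIn arcs P {t}) (s a b u w : V) (hwP : w ∈ P)
    (hAPL : AbstractPendantLemma (R := R) P w)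
    (ha : a ∉ P ∪ {t}) (hb : b ∉ P ∪ {t}) (hu : u ∉ P ∪ {t})
    (hP : ∀ Z ∈ P.powerset, 0 < prob p (avoidEvent (arcsOff arcs (P ∪ {t})) s (Z ∪ {t})))
    (hQ : ∀ Z ∈ P.powerset,
      0 < prob p (avoidEvent (arcsOff arcs (P ∪ {t})) s (gateTarget u w Z {t}))) :
    DARC p arcs s {t} a b u w := by
  have hS₀ : SameEnds (arcsOff arcs (P ∪ {t})) := sameEnds_arcsOff hS _
  refine darc_of_trace_functional p hp hS hclosed hT s a b u w hwP ha hb hu hQ ?_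
  set D₀ := arcsOff arcs (P ∪ {t}) with hD₀
  set X₀ : Config E → R := marker D₀ s a with hX₀
  set Y₀ : Config E → R := marker D₀ s b with hY₀
  -- the trace data
  set ℓ : Finset V → R := fun Z => prob p (traceLevel arcs {t} P Z) with hℓ
  set Pz : Finset V → R := fun Z => prob p (avoidEvent D₀ s (Z ∪ {t})) with hPz
  set Qz : Finset V → R := fun Z => prob p (avoidEvent D₀ s (gateTarget u w Z {t})) with hQz
  set Az : Finset V → R := fun Z => massE p X₀ (avoidEvent D₀ s (Z ∪ {t})) with hAz
  set Bz : Finset V → R := fun Z => massE p Y₀ (avoidEvent D₀ s (Z ∪ {t})) with hBz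
  set Ahz : Finset V → R := fun Z => massE p X₀ (avoidEvent D₀ s (gateTarget u w Z {t})) with hAhz
  set Bhz : Finset V → R := fun Z => massE p Y₀ (avoidEvent D₀ s (gateTarget u w Z {t})) with hBhz
  have hPpos : ∀ Z : Finset V, Z ⊆ P → 0 < Pz Z := fun Z hZ => hP Z (Finset.mem_powerset.mpr hZ)
  have hQpos : ∀ Z : Finset V, Z ⊆ P → 0 < Qz Z := fun Z hZ => hQ Z (Finset.mem_powerset.mpr hZ)
  -- the abstract data
  have hMX : ∑ Z ∈ P.powerset, Az Z / Pz Z * (ℓ Z * Pz Z) = ∑ Z ∈ P.powerset, ℓ Z * Az Z := by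
    refine Finset.sum_congr rfl fun Z hZ => ?_
    have := (hPpos Z (Finset.mem_powerset.mp hZ)).ne'
    field_simp
  have hMY : ∑ Z ∈ P.powerset, Bz Z / Pz Z * (ℓ Z * Pz Z) = ∑ Z ∈ P.powerset, ℓ Z * Bz Z := by
    refine Finset.sum_congr rfl fun Z hZ => ?_
    have := (hPpos Z (Finset.mem_powerset.mp hZ)).ne'
    field_simp
  have key : ∑ Z ∈ P.powerset, ℓ Z * Pz Z * (Qz Z / Pz Z) *
        (Ahz Z / Qz Z * (∑ Z' ∈ P.powerset, ℓ Z' * Pz Z')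
          - ∑ Z' ∈ P.powerset, Az Z' / Pz Z' * (ℓ Z' * Pz Z')) *
        (Bhz Z / Qz Z * (∑ Z' ∈ P.powerset, ℓ Z' * Pz Z')
          - ∑ Z' ∈ P.powerset, Bz Z' / Pz Z' * (ℓ Z' * Pz Z')) =
      ∑ Z ∈ P.powerset, ℓ Z * Qz Z *
        (Ahz Z / Qz Z * (∑ Z' ∈ P.powerset, ℓ Z' * Pz Z') - ∑ Z' ∈ P.powerset, ℓ Z' * Az Z') *
        (Bhz Z / Qz Z * (∑ Z' ∈ P.powerset, ℓ Z' * Pz Z') - ∑ Z' ∈ P.powerset, ℓ Z' * Bz Z') := by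
    rw [hMX, hMY]
    refine Finset.sum_congr rfl fun Z hZ => ?_
    have := (hPpos Z (Finset.mem_powerset.mp hZ)).ne'
    field_simp
  rw [← key]
  -- the hypotheses of the abstract lemma
  have hμ : ∀ Z ∈ P.powerset, 0 ≤ ℓ Z * Pz Z :=
    fun Z _ => mul_nonneg (prob_nonneg hp _) (prob_nonneg hp _)
  have hx1 : ∀ Z : Finset V, Z ⊆ P → Az Z / Pz Z ≤ 1 := fun Z hZ =>
    (div_le_one₀ (hPpos Z hZ)).mpr (massE_marker_le_prob p hp D₀ s a _)
  have hy1 : ∀ Z : Finset V, Z ⊆ P → Bz Z / Pz Z ≤ 1 := fun Z hZ =>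
    (div_le_one₀ (hPpos Z hZ)).mpr (massE_marker_le_prob p hp D₀ s b _)
  have hxh1 : ∀ Z : Finset V, Z ⊆ P → Ahz Z / Qz Z ≤ 1 := fun Z hZ =>
    (div_le_one₀ (hQpos Z hZ)).mpr (massE_marker_le_prob p hp D₀ s a _)
  have hyh1 : ∀ Z : Finset V, Z ⊆ P → Bhz Z / Qz Z ≤ 1 := fun Z hZ =>
    (div_le_one₀ (hQpos Z hZ)).mpr (massE_marker_le_prob p hp D₀ s b _)
  have hxanti : ∀ Z Z' : Finset V, Z ⊆ Z' → Z' ⊆ P → Az Z' / Pz Z' ≤ Az Z / Pz Z :=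
    fun Z Z' hZZ' hZ'P => (div_le_div_iff₀ (hPpos Z' hZ'P) (hPpos Z (hZZ'.trans hZ'P))).mpr
      (shift_avoid_more_C p hp hS₀ s a (Finset.union_subset_union_left hZZ'))
  have hyanti : ∀ Z Z' : Finset V, Z ⊆ Z' → Z' ⊆ P → Bz Z' / Pz Z' ≤ Bz Z / Pz Z :=
    fun Z Z' hZZ' hZ'P => (div_le_div_iff₀ (hPpos Z' hZ'P) (hPpos Z (hZZ'.trans hZ'P))).mpr
      (shift_avoid_more_C p hp hS₀ s b (Finset.union_subset_union_left hZZ'))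
  have hxhanti : ∀ Z Z' : Finset V, Z ⊆ Z' → Z' ⊆ P → Ahz Z' / Qz Z' ≤ Ahz Z / Qz Z :=
    fun Z Z' hZZ' hZ'P => (div_le_div_iff₀ (hQpos Z' hZ'P) (hQpos Z (hZZ'.trans hZ'P))).mpr
      (shift_avoid_more_C p hp hS₀ s a (gateTarget_mono u w hZZ' {t}))
  have hyhanti : ∀ Z Z' : Finset V, Z ⊆ Z' → Z' ⊆ P → Bhz Z' / Qz Z' ≤ Bhz Z / Qz Z :=
    fun Z Z' hZZ' hZ'P => (div_le_div_iff₀ (hQpos Z' hZ'P) (hQpos Z (hZZ'.trans hZ'P))).mpr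
      (shift_avoid_more_C p hp hS₀ s b (gateTarget_mono u w hZZ' {t}))
  have hxh_le : ∀ Z : Finset V, Z ⊆ P → Ahz Z / Qz Z ≤ Az Z / Pz Z := fun Z hZ =>
    (div_le_div_iff₀ (hQpos Z hZ) (hPpos Z hZ)).mpr
      (shift_avoid_more_C p hp hS₀ s a (subset_gateTarget u w Z {t}))
  have hyh_le : ∀ Z : Finset V, Z ⊆ P → Bhz Z / Qz Z ≤ Bz Z / Pz Z := fun Z hZ =>
    (div_le_div_iff₀ (hQpos Z hZ) (hPpos Z hZ)).mpr
      (shift_avoid_more_C p hp hS₀ s b (subset_gateTarget u w Z {t}))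
  have hxh_eq : ∀ Z : Finset V, Z ⊆ P → w ∉ Z → Ahz Z / Qz Z = Az Z / Pz Z := by
    intro Z _ hwZ
    show massE p X₀ (avoidEvent D₀ s (gateTarget u w Z {t})) /
        prob p (avoidEvent D₀ s (gateTarget u w Z {t})) = _
    rw [gateTarget_of_notMem hwZ]
  have hyh_eq : ∀ Z : Finset V, Z ⊆ P → w ∉ Z → Bhz Z / Qz Z = Bz Z / Pz Z := by
    intro Z _ hwZ
    show massE p Y₀ (avoidEvent D₀ s (gateTarget u w Z {t})) /
        prob p (avoidEvent D₀ s (gateTarget u w Z {t})) = _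
    rw [gateTarget_of_notMem hwZ]
  have hρ1 : ∀ Z ∈ P.powerset, w ∉ Z → Qz Z / Pz Z = 1 := by
    intro Z hZ hwZ
    show prob p (avoidEvent D₀ s (gateTarget u w Z {t})) / prob p (avoidEvent D₀ s (Z ∪ {t})) = 1
    rw [gateTarget_of_notMem hwZ]
    exact div_self (hP Z hZ).ne'
  have hρ0 : ∀ Z ∈ P.powerset, 0 ≤ Qz Z / Pz Z :=
    fun Z _ => div_nonneg (prob_nonneg hp _) (prob_nonneg hp _)
  have hρle : ∀ Z ∈ P.powerset, Qz Z / Pz Z ≤ 1 := fun Z hZ =>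
    (div_le_one₀ (hP Z hZ)).mpr
      (prob_mono hp fun ω hω t' ht' => hω t' (subset_gateTarget u w Z {t} ht'))
  have hρmono : ∀ Z Z' : Finset V, Z ⊆ Z' → Z' ⊆ P → w ∈ Z → Qz Z / Pz Z ≤ Qz Z' / Pz Z' :=
    fun Z Z' hZZ' hZ'P hw =>
      (div_le_div_iff₀ (hPpos Z (hZZ'.trans hZ'P)) (hPpos Z' hZ'P)).mpr
        (rho_mono_of_subset p hp hS s u w hu hZZ' hZ'P hw)
  have hPA : TracePA P (fun Z => ℓ Z * Pz Z) := by
    intro U hU f₁ f₂ h₁ h₂ h₁0 h₂0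
    have h := trace_pa p hp hS hclosed hT hU s (monotone_traceFn P h₁) (monotone_traceFn P h₂)
      (traceFn_nonneg P h₁0) (traceFn_nonneg P h₂0)
    have e₁ : ∑ Z ∈ P.powerset.filter (fun Z => Disjoint Z U),
        traceFn P f₁ ↑Z * (ℓ Z * Pz Z) =
        ∑ Z ∈ P.powerset.filter (fun Z => Disjoint Z U), f₁ Z * (ℓ Z * Pz Z) :=
      Finset.sum_congr rfl fun Z hZ => by
        rw [traceFn_coe P f₁ (Finset.mem_powerset.mp (Finset.mem_filter.mp hZ).1)]
    have e₂ : ∑ Z ∈ P.powerset.filter (fun Z => Disjoint Z U),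
        traceFn P f₂ ↑Z * (ℓ Z * Pz Z) =
        ∑ Z ∈ P.powerset.filter (fun Z => Disjoint Z U), f₂ Z * (ℓ Z * Pz Z) :=
      Finset.sum_congr rfl fun Z hZ => by
        rw [traceFn_coe P f₂ (Finset.mem_powerset.mp (Finset.mem_filter.mp hZ).1)]
    have e₁₂ : ∑ Z ∈ P.powerset.filter (fun Z => Disjoint Z U),
        traceFn P f₁ ↑Z * traceFn P f₂ ↑Z * (ℓ Z * Pz Z) =
        ∑ Z ∈ P.powerset.filter (fun Z => Disjoint Z U), f₁ Z * f₂ Z * (ℓ Z * Pz Z) :=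
      Finset.sum_congr rfl fun Z hZ => by
        rw [traceFn_coe P f₁ (Finset.mem_powerset.mp (Finset.mem_filter.mp hZ).1),
          traceFn_coe P f₂ (Finset.mem_powerset.mp (Finset.mem_filter.mp hZ).1)]
    rw [e₁, e₂, e₁₂] at h
    exact h
  exact hAPL (fun Z => ℓ Z * Pz Z) (fun Z => Az Z / Pz Z) (fun Z => Bz Z / Pz Z)
    (fun Z => Ahz Z / Qz Z) (fun Z => Bhz Z / Qz Z) (fun Z => Qz Z / Pz Z) hμ hPA hx1 hy1 hxh1
    hyh1 hxanti hyanti hxhanti hyhanti hxh_le hyh_le hxh_eq hyh_eq hρ1 hρ0 hρle hρmono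

end Reduction

end Summit.Ventures.PercRepro2.Coin
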